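import Summits.CriticalPhenomena.PercolationContinuityZ3.Theorems.PercNearOneGluingNearOneGluingKnLemma3i
import HarnessLib

/-! # Crux `PercNearOneGluing.AdditiveGluing` (stmt-CriticalPhenomena-4576) — Kozma–Nitzan's Lemma 3(i) with SIGNED slack
# (seat (b) V⁺-form, depth prover `png-dp-vplus`)

Support file (`--supports stmt-CriticalPhenomena-4576`); no definitions, no named facts.

`μ = prodBernoulli w` on the bond configurations of `Fin n`; `Q` increasing and determined by the open edge cluster of `a₂`;
`N = {a₁ ↮ a₂}`.  The landed `knLemma3i` / `knLemma3i_sharp` transfer a NON-NEGATIVE slack `d ≥ μ(a₁↔b) − μ(a₂↔b)`: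
`μ(N)·μ(a₁↔b, Q) ≤ μ(N)·μ(a₂↔b, Q) + d·μ(N ∩ Q)`.  The same two BHK inequalities give the statement with the EXACT, possibly
negative, difference:

  `μ(N) · [μ(Q ∩ {a₁ ↔ b}) − μ(Q ∩ {a₂ ↔ b})] ≤ [μ(a₁ ↔ b) − μ(a₂ ↔ b)] · μ(N ∩ Q)`      (`knLemma3i_signed`)

i.e. a DEFICIT of `a₁` below `a₂` survives the localisation to `Q` with the conditional factor `μ(Q | a₁ ↮ a₂)` (whereas a surplus
is transferred with at most that factor).  Proof: off `N` the events `{a₁↔b}`, `{a₂↔b}` coincide, so `x₁ − x₂ = μ(a₁↔b) − μ(a₂↔b)`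
with `x_i = μ(N ∩ {a_i↔b})`; BHK 2006 Thm 1.4 (`knLemma3i_twoCluster`): `m·y₁ ≤ x₁·q`, Thm 1.3 (`knLemma3i_oneCluster`): `x₂·q ≤ m·y₂`,
whence `m(y₁ − y₂) ≤ (x₁ − x₂) q`.  This is the negative-slack tool of the V⁺ certificate calculus (a designation strictly below a
relay keeps a computable part of its deficit after conditioning / gluing).
[cite: KozmaNitzan2024, Lemma 3(i) (pp. 6–7); VandenbergHaggstromKahn2005, Thm. 1.3 (p. 6), Thm. 1.4 (p. 7)]
-/

namespace Summit.CriticalPhenomena.PercolationContinuityZ3.Theorems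

open MeasureTheory Set
open Literature.Probability.LatticeModels (prodBernoulli)
open Literature.Probability.Percolation (BondConfig openConn openGraph openEdgeCluster)

noncomputable section
open Classical

section KnLemma3iSigned

open Literature.Probability.LatticeModels Literature.Probability.Percolation

variable {n : ℕ}

/-- **KN Lemma 3(i), signed conditional form.**  For `Q` increasing and determined by the open edge cluster of `a₂`, with
`N = {a₁ ↮ a₂}`:  `μ(N)·[μ(a₁↔b ∩ Q) − μ(a₂↔b ∩ Q)] ≤ [μ(a₁↔b) − μ(a₂↔b)]·μ(N ∩ Q)` — no sign condition on the difference.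
(BHK 2006 Thms 1.3/1.4 exactly as in the landed `knLemma3i_sharp`, keeping the sign.)
[cite: KozmaNitzan2024, Lemma 3(i) (pp. 6–7); VandenbergHaggstromKahn2005, Thms. 1.3–1.4] -/
theorem knLemma3i_signed (w : Sym2 (Fin n) → unitInterval) (a₁ a₂ b : Fin n)
    (Q : Set (BondConfig (Fin n)))
    (hQ : ∀ ω ω', ω ∈ Q → openEdgeCluster ω a₂ ⊆ openEdgeCluster ω' a₂ → ω' ∈ Q) :
    (prodBernoulli w).real (openConn a₁ a₂)ᶜ *
        ((prodBernoulli w).real (openConn a₁ b ∩ Q) - (prodBernoulli w).real (openConn a₂ b ∩ Q)) ≤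
      ((prodBernoulli w).real (openConn a₁ b) - (prodBernoulli w).real (openConn a₂ b)) *
        (prodBernoulli w).real ((openConn a₁ a₂)ᶜ ∩ Q) := by
  rcases eq_or_ne a₁ a₂ with h12 | h12
  · subst h12
    simp only [sub_self, mul_zero, zero_mul, le_refl]
  have hDm : MeasurableSet ((openConn a₁ a₂)ᶜ : Set (BondConfig (Fin n))) := MeasurableSet.of_discrete
  have hagree : ∀ E : Set (BondConfig (Fin n)),
      (openConn a₁ b ∩ E) \ (openConn a₁ a₂)ᶜ = (openConn a₂ b ∩ E) \ (openConn a₁ a₂)ᶜ := by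
    intro E
    ext ω
    simp only [Set.mem_sdiff, Set.mem_inter_iff, Set.mem_compl_iff, not_not]
    constructor
    · rintro ⟨⟨h1, hE⟩, h2⟩
      exact ⟨⟨SimpleGraph.Reachable.trans (SimpleGraph.Reachable.symm h2) h1, hE⟩, h2⟩
    · rintro ⟨⟨h1, hE⟩, h2⟩
      exact ⟨⟨SimpleGraph.Reachable.trans h2 h1, hE⟩, h2⟩
  have hs1 := measureReal_inter_add_sdiff (μ := prodBernoulli w) (s := openConn a₁ b) hDm
  have hs2 := measureReal_inter_add_sdiff (μ := prodBernoulli w) (s := openConn a₂ b) hDm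
  have hs1Q := measureReal_inter_add_sdiff (μ := prodBernoulli w) (s := openConn a₁ b ∩ Q) hDm
  have hs2Q := measureReal_inter_add_sdiff (μ := prodBernoulli w) (s := openConn a₂ b ∩ Q) hDm
  have he : (prodBernoulli w).real (openConn a₁ b \ (openConn a₁ a₂)ᶜ) =
      (prodBernoulli w).real (openConn a₂ b \ (openConn a₁ a₂)ᶜ) := by
    have h := hagree Set.univ
    simp only [Set.inter_univ] at h
    rw [h]
  have heQ : (prodBernoulli w).real ((openConn a₁ b ∩ Q) \ (openConn a₁ a₂)ᶜ) =
      (prodBernoulli w).real ((openConn a₂ b ∩ Q) \ (openConn a₁ a₂)ᶜ) := by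
    rw [hagree Q]
  rw [Set.inter_comm (openConn a₁ b) (openConn a₁ a₂)ᶜ] at hs1
  rw [Set.inter_comm (openConn a₂ b) (openConn a₁ a₂)ᶜ] at hs2
  rw [Set.inter_comm (openConn a₁ b ∩ Q) (openConn a₁ a₂)ᶜ] at hs1Q
  rw [Set.inter_comm (openConn a₂ b ∩ Q) (openConn a₁ a₂)ᶜ] at hs2Q
  have hI := knLemma3i_oneCluster w a₂ a₁ b Q hQ h12.symm
  have hcomm : (openConn a₂ a₁ : Set (BondConfig (Fin n))) = openConn a₁ a₂ :=
    Set.ext fun _ => ⟨fun h => SimpleGraph.Reachable.symm h, fun h => SimpleGraph.Reachable.symm h⟩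
  rw [hcomm] at hI
  have hII := knLemma3i_twoCluster w a₁ a₂ b Q hQ h12
  -- `x₁ − x₂ = τ(a₁) − τ(a₂)` (off `N` the events agree)
  have hx : (prodBernoulli w).real ((openConn a₁ a₂)ᶜ ∩ openConn a₁ b) -
      (prodBernoulli w).real ((openConn a₁ a₂)ᶜ ∩ openConn a₂ b) =
      (prodBernoulli w).real (openConn a₁ b) - (prodBernoulli w).real (openConn a₂ b) := by
    linarith
  have hNQ0 : 0 ≤ (prodBernoulli w).real ((openConn a₁ a₂)ᶜ ∩ Q) := measureReal_nonneg
  -- the conditional chain on `N`: `m y₁ ≤ x₁ q` and `x₂ q ≤ m y₂`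
  have hchain : (prodBernoulli w).real (openConn a₁ a₂)ᶜ *
      ((prodBernoulli w).real ((openConn a₁ a₂)ᶜ ∩ (openConn a₁ b ∩ Q)) -
        (prodBernoulli w).real ((openConn a₁ a₂)ᶜ ∩ (openConn a₂ b ∩ Q))) ≤
      ((prodBernoulli w).real ((openConn a₁ a₂)ᶜ ∩ openConn a₁ b) -
        (prodBernoulli w).real ((openConn a₁ a₂)ᶜ ∩ openConn a₂ b)) *
        (prodBernoulli w).real ((openConn a₁ a₂)ᶜ ∩ Q) := by
    have h1 := hII
    have h2 := hI
    nlinarith [h1, h2]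
  rw [hx] at hchain
  -- off `N` the two `Q`-events agree
  have hy : (prodBernoulli w).real (openConn a₁ b ∩ Q) - (prodBernoulli w).real (openConn a₂ b ∩ Q) =
      (prodBernoulli w).real ((openConn a₁ a₂)ᶜ ∩ (openConn a₁ b ∩ Q)) -
        (prodBernoulli w).real ((openConn a₁ a₂)ᶜ ∩ (openConn a₂ b ∩ Q)) := by
    linarith
  rw [hy]
  exact hchain

/-- **Exchange form with signed slack.**  Under the hypotheses of `knLemma3i_signed`, removing the common part
`Q ∩ {a₁↔b} ∩ {a₂↔b}`:  `μ(N)·[μ(Q, a₁↔b, a₂↮b) − μ(Q, a₂↔b, a₁↮b)] ≤ [μ(a₁↔b) − μ(a₂↔b)]·μ(N ∩ Q)`.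
[cite: KozmaNitzan2024, Lemma 3(i) (pp. 6–7)] -/
theorem knLemma3i_signed_exchange (w : Sym2 (Fin n) → unitInterval) (a₁ a₂ b : Fin n)
    (Q : Set (BondConfig (Fin n)))
    (hQ : ∀ ω ω', ω ∈ Q → openEdgeCluster ω a₂ ⊆ openEdgeCluster ω' a₂ → ω' ∈ Q) :
    (prodBernoulli w).real (openConn a₁ a₂)ᶜ *
        ((prodBernoulli w).real (Q ∩ openConn a₁ b ∩ (openConn a₂ b)ᶜ) -
          (prodBernoulli w).real (Q ∩ openConn a₂ b ∩ (openConn a₁ b)ᶜ)) ≤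
      ((prodBernoulli w).real (openConn a₁ b) - (prodBernoulli w).real (openConn a₂ b)) *
        (prodBernoulli w).real ((openConn a₁ a₂)ᶜ ∩ Q) := by
  have h := knLemma3i_signed w a₁ a₂ b Q hQ
  have hmeas : ∀ s : Set (BondConfig (Fin n)), MeasurableSet s := fun _ => MeasurableSet.of_discrete
  have h1 := measureReal_inter_add_sdiff (μ := prodBernoulli w) (s := openConn a₁ b ∩ Q) (hmeas (openConn a₂ b))
  have h2 := measureReal_inter_add_sdiff (μ := prodBernoulli w) (s := openConn a₂ b ∩ Q) (hmeas (openConn a₁ b))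
  have hc : (openConn a₁ b ∩ Q) ∩ openConn a₂ b = (openConn a₂ b ∩ Q) ∩ openConn a₁ b := by
    ext ω
    simp only [Set.mem_inter_iff]
    tauto
  have hd1 : (openConn a₁ b ∩ Q) \ openConn a₂ b = Q ∩ openConn a₁ b ∩ (openConn a₂ b)ᶜ := by
    ext ω
    simp only [Set.mem_sdiff, Set.mem_inter_iff, Set.mem_compl_iff]
    tauto
  have hd2 : (openConn a₂ b ∩ Q) \ openConn a₁ b = Q ∩ openConn a₂ b ∩ (openConn a₁ b)ᶜ := by
    ext ω
    simp only [Set.mem_sdiff, Set.mem_inter_iff, Set.mem_compl_iff]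
    tauto
  rw [hc, hd1] at h1
  rw [hd2] at h2
  have heq : (prodBernoulli w).real (openConn a₁ b ∩ Q) - (prodBernoulli w).real (openConn a₂ b ∩ Q) =
      (prodBernoulli w).real (Q ∩ openConn a₁ b ∩ (openConn a₂ b)ᶜ) -
        (prodBernoulli w).real (Q ∩ openConn a₂ b ∩ (openConn a₁ b)ᶜ) := by
    linarith
  rw [heq] at h
  exact h


/-- Registered rung `stub_knLemma3iSigned_vp` of crux stmt-CriticalPhenomena-4576 (depth prover png-dp-vplus, seat (b) V⁺-form): KN Lemma 3(i) with signed slack — `knLemma3i_signed`, closed statement. [cite: KozmaNitzan2024, Lemma 3(i) (pp. 6–7)] -/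
theorem stub_knLemma3iSigned_vp : ∀ (n : ℕ) (w : Sym2 (Fin n) → unitInterval) (a₁ a₂ b : Fin n) (Q : Set (Literature.Probability.Percolation.BondConfig (Fin n))), (∀ ω ω', ω ∈ Q → Literature.Probability.Percolation.openEdgeCluster ω a₂ ⊆ Literature.Probability.Percolation.openEdgeCluster ω' a₂ → ω' ∈ Q) → (Literature.Probability.LatticeModels.prodBernoulli w).real (Literature.Probability.Percolation.openConn a₁ a₂)ᶜ * ((Literature.Probability.LatticeModels.prodBernoulli w).real (Literature.Probability.Percolation.openConn a₁ b ∩ Q) - (Literature.Probability.LatticeModels.prodBernoulli w).real (Literature.Probability.Percolation.openConn a₂ b ∩ Q)) ≤ ((Literature.Probability.LatticeModels.prodBernoulli w).real (Literature.Probability.Percolation.openConn a₁ b) - (Literature.Probability.LatticeModels.prodBernoulli w).real (Literature.Probability.Percolation.openConn a₂ b)) * (Literature.Probability.LatticeModels.prodBernoulli w).real ((Literature.Probability.Percolation.openConn a₁ a₂)ᶜ ∩ Q) :=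
  fun _ w a₁ a₂ b Q hQ => knLemma3i_signed w a₁ a₂ b Q hQ

end KnLemma3iSigned

end

end Summit.CriticalPhenomena.PercolationContinuityZ3.Theorems
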